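import Mathlib
import HarnessLib
import Summits.NavierStokesRegularity.NavierStokesRegularity.Theorems.QuarterLogPincerColdSmoothingDefs
import Summits.NavierStokesRegularity.NavierStokesRegularity.Theorems.QuarterLogPincerColdSmoothingPressureGauge
import Summits.NavierStokesRegularity.NavierStokesRegularity.Theorems.QuarterLogPincerColdSmoothingSmallEnergy
import Literature.Analysis.FluidPDE.PressureDecayEstimateProofs
import Literature.Analysis.FluidPDE.NSBoundedHigherRegularityOfLemma61

/-!
# Route `QuarterLogPincer`, crux `TypeIQuantSubcubicExp` (stmt-NavierStokesRegularity-24077), line `flat_chain` —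
# β step 1: BOUNDED cylinders of a Type-I frame solution are quantitatively regular (all derivatives of order ≤ 2)

Helper toward the registered stub β|P `stub_lightSliceRegular_of_slice : LocalEnergySlice → LightSliceRegular` of
ns-idea-7 g14's skeleton `Cruxes/TypeIQuantSubcubicExp/Lines/flat_chain.lean` (v1.13).  It replaces the «higher
regularity on a cylinder» step of the author's execution plan (`NSBoundedHigherRegularityBounds` + pressure budget) by the
PROVED cold-smoothing kernel of the E-chain, with BOUNDEDNESS in place of coldness: the twin of
`ColdSmoothing.coldRegularity_of_stubs` (`…ColdSmoothingKernel`) where CS1 (`ColdCube`, cold ⇒ `C(ρ) ≤ C₁ε`) is replaced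
by `cknC_le_of_ae_bound_subset` (`|u| ≤ K` on `Q_ρ(z)` ⇒ `C(ρ') ≤ |B₁|K³ρ'³ ≤ |B₁|(Kρ)³`), CS2
`ColdSmoothing.stub_coldPressureGauge` (the ball-gauged pressure is suitable with `D(ρ) ≤ C₂(M)`, PROVED p714176), the
pressure decay `seregin_sverak_pressure_decay_holds` (one step `D(θρ) ≤ c(θD(ρ) + θ⁻²C(ρ))`) and CS3
`ColdSmoothing.stub_smallEnergySmoothing` (`C + D < ε⋆` ⇒ `‖∇ʲu‖ ≤ c⋆r^{-(j+1)}`, `j ≤ 2`, PROVED p714571):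

* `boundedRegularity` — for `M ≥ 1` there are `θ ∈ (0,1]`, `κ > 0`, `c⋆ ≥ 1` such that, in the crux frame with rate
  `M`, every backward cylinder `Q_ρ(z)` (`ρ² ≤ z₁ ≤ T`) on which `‖u‖ ≤ K` with `Kρ ≤ κ` carries
  `‖∇ʲu(t,x)‖ ≤ c⋆(θρ)^{-(j+1)}` for `t ∈ [z₁ − (θρ/2)², z₁]`, `x ∈ B(z₂, θρ/2)`, `j ≤ 2`.

HONEST FRAMING: a composition of PROVED tree theorems about HYPOTHETICAL Type-I classical solutions; nothing here
bears on the truth of ⟨24077⟩, the wall W7 or Navier–Stokes regularity (OPEN / not proved).  pub-ns-dss typer (g39),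
`--supports stmt-NavierStokesRegularity-24077`.
-/

set_option linter.dupNamespace false

noncomputable section

open MeasureTheory Set Function Filter Topology Metric
open scoped ENNReal NNReal Classical
open Literature.Analysis Literature.Analysis.FluidPDE
open Summit.NavierStokesRegularity.NavierStokesRegularity.Cruxes.TypeIQuantSubcubicExp.ColdSmoothing

namespace Summit.NavierStokesRegularity.NavierStokesRegularity.Cruxes.TypeIQuantSubcubicExp.FlatChain

/-- **Bounded cylinders are quantitatively regular** (see the module docstring). -/
theorem boundedRegularity :
    ∀ M : ℝ, 1 ≤ M → ∃ θ κ cs : ℝ, 0 < θ ∧ θ ≤ 1 ∧ 0 < κ ∧ 1 ≤ cs ∧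
      ∀ (T τ : ℝ) (u : ℝ → (EuclideanSpace ℝ (Fin 3)) → (EuclideanSpace ℝ (Fin 3)))
        (p : ℝ → (EuclideanSpace ℝ (Fin 3)) → ℝ), Frame T u p → 0 < τ → Rate M T τ u →
        ∀ (K : ℝ) (z : ℝ × (EuclideanSpace ℝ (Fin 3))) (ρ : ℝ), 0 ≤ K → 0 < ρ → ρ ^ 2 ≤ z.1 → z.1 ≤ T →
          (∀ w ∈ parabolicCylinder ρ z, ‖u w.1 w.2‖ ≤ K) → K * ρ ≤ κ →
          ∀ t ∈ Icc (z.1 - (θ * ρ / 2) ^ 2) z.1, ∀ x ∈ ball z.2 (θ * ρ / 2), ∀ j : ℕ, j ≤ 2 →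
            ‖iteratedFDeriv ℝ j (u t) x‖ ≤ cs * (θ * ρ) ^ (-((j : ℝ) + 1)) := by
  intro M hM
  obtain ⟨C₂, hC₂, H2⟩ := stub_coldPressureGauge M hM
  obtain ⟨εs, cs, hεs, hcs, H3⟩ := stub_smallEnergySmoothing
  obtain ⟨c, Hc⟩ := seregin_sverak_pressure_decay_holds
  set Kc : ℝ := (c : ℝ) + 1 with hKc
  have hc0 : 0 ≤ (c : ℝ) := c.coe_nonneg
  have hKc1 : 1 ≤ Kc := by rw [hKc]; linarith
  have hKc0 : 0 < Kc := by linarith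
  -- the ratio `θ(M)`, the smallness budget `E₀(M)` and the product cap `κ(M)`
  set θ : ℝ := min (1 / 2) (εs / (4 * Kc * C₂)) with hθ
  have hθpos : 0 < θ := by
    rw [hθ]; refine lt_min (by norm_num) ?_; positivity
  have hθhalf : θ ≤ 1 / 2 := min_le_left _ _
  have hθ1 : θ ≤ 1 := hθhalf.trans (by norm_num)
  have hθC₂ : θ * (4 * Kc * C₂) ≤ εs := by
    have : θ ≤ εs / (4 * Kc * C₂) := min_le_right _ _
    rwa [le_div_iff₀ (by positivity)] at this
  set E₀ : ℝ := εs * θ ^ 2 / (4 * Kc) with hE₀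
  have hE₀pos : 0 < E₀ := by rw [hE₀]; positivity
  set b₁ : ℝ := (volume (ball (0 : (EuclideanSpace ℝ (Fin 3))) 1)).toReal with hb₁
  have hb₁pos : 0 < b₁ := by
    rw [hb₁]; exact ENNReal.toReal_pos (measure_ball_pos volume _ one_pos).ne' measure_ball_lt_top.ne
  have hvol : volume (ball (0 : (EuclideanSpace ℝ (Fin 3))) 1) = ENNReal.ofReal b₁ := by
    rw [hb₁, ENNReal.ofReal_toReal measure_ball_lt_top.ne]
  set κ : ℝ := (E₀ / b₁) ^ (1 / 3 : ℝ) with hκ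
  have hκpos : 0 < κ := by rw [hκ]; exact Real.rpow_pos_of_pos (by positivity) _
  have hκ3 : κ ^ 3 = E₀ / b₁ := by
    rw [hκ, ← Real.rpow_natCast, ← Real.rpow_mul (by positivity)]; norm_num
  refine ⟨θ, κ, cs, hθpos, hθ1, hκpos, hcs, ?_⟩
  intro T τ u p hframe hτ hrate K z ρ hK hρ hρz hzT hbd hKρ
  -- the smaller cylinder `Q_{θρ}(z)`
  have hθρ : 0 < θ * ρ := mul_pos hθpos hρ
  have hθρle : θ * ρ ≤ ρ := by nlinarith
  have hsub : parabolicCylinder (θ * ρ) z ⊆ parabolicCylinder ρ z := parabolicCylinder_mono hθρ.le hθρle z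
  have hθρz : (θ * ρ) ^ 2 ≤ z.1 := le_trans (by nlinarith) hρz
  -- `C(ρ') ≤ |B₁| K³ρ'³ ≤ E₀` at both scales (boundedness replaces coldness)
  have hbd_ae : ∀ᵐ w ∂(volume.restrict (parabolicCylinder ρ z)), ‖u w.1 w.2‖ ≤ K :=
    (ae_restrict_iff' (measurableSet_Ioo.prod measurableSet_ball)).2 (Eventually.of_forall hbd)
  have hKρ3 : K ^ 3 * ρ ^ 3 ≤ E₀ / b₁ := by
    rw [← mul_pow, ← hκ3]; exact pow_le_pow_left₀ (by positivity) hKρ 3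
  have hC_scale : ∀ ρ' : ℝ, 0 < ρ' → ρ' ≤ ρ → cknC ρ' z u ≤ ENNReal.ofReal E₀ := by
    intro ρ' hρ' hρ'le
    have h1 := cknC_le_of_ae_bound_subset hK hbd_ae hρ' (parabolicCylinder_mono hρ'.le hρ'le z)
    refine h1.trans ?_
    rw [hvol, ← ENNReal.ofReal_mul (by positivity)]
    refine ENNReal.ofReal_le_ofReal ?_
    have h2 : K ^ 3 * ρ' ^ 3 ≤ K ^ 3 * ρ ^ 3 :=
      mul_le_mul_of_nonneg_left (pow_le_pow_left₀ hρ'.le hρ'le 3) (by positivity)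
    calc K ^ 3 * ρ' ^ 3 * b₁ ≤ (E₀ / b₁) * b₁ := mul_le_mul_of_nonneg_right (h2.trans hKρ3) hb₁pos.le
      _ = E₀ := by field_simp
  have hC_small : cknC (θ * ρ) z u ≤ ENNReal.ofReal E₀ := hC_scale (θ * ρ) hθρ hθρle
  have hC_big : cknC ρ z u ≤ ENNReal.ofReal E₀ := hC_scale ρ hρ le_rfl
  -- CS2 at scale `ρ`
  obtain ⟨hball, hD⟩ := H2 T τ u p hframe hτ hrate z ρ hρ hρz hzT
  set q : ℝ → (EuclideanSpace ℝ (Fin 3)) → ℝ := ballGauge p z.2 ρ with hq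
  have hIn : IsSuitableWeakSolutionInBall (θ * ρ) z u q := hball (θ * ρ) hθρ hθρle
  have hInρ : IsSuitableWeakSolutionInBall ρ z u q := hball ρ hρ le_rfl
  -- ONE pressure-decay step (tree theorem, Seregin–Šverák (as13))
  have hdist : IsDistributionalNSSolutionOn (parabolicCylinderOpens ρ z) 1 0 u q := hInρ.1.distributional
  have hstep := Hc (parabolicCylinderOpens ρ z) u q hdist z ρ (θ * ρ) hθρ hθρle (fun w hw => hw)
  have hratio : θ * ρ / ρ = θ := by field_simp
  have hratio' : (ρ / (θ * ρ)) ^ 2 = 1 / θ ^ 2 := by field_simp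
  rw [hratio, hratio'] at hstep
  -- assemble the smallness `C(θρ) + D(θρ) < ε⋆`
  have hA : E₀ ≤ εs / 16 := by
    have h2' : E₀ = εs * θ ^ 2 / (4 * Kc) := rfl
    have h3' : εs * θ ^ 2 / (4 * Kc) ≤ εs * (1 / 2) ^ 2 / (4 * 1) := by
      apply div_le_div₀ (by positivity) ?_ (by norm_num) (by linarith)
      exact mul_le_mul_of_nonneg_left (pow_le_pow_left₀ hθpos.le hθhalf 2) hεs.le
    linarith
  have hB : (c : ℝ) * (θ * C₂) ≤ εs / 4 := by
    have : (c : ℝ) * (θ * C₂) ≤ Kc * (θ * C₂) := mul_le_mul_of_nonneg_right (by linarith) (by positivity)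
    nlinarith
  have hC : (c : ℝ) * (1 / θ ^ 2 * E₀) ≤ εs / 4 := by
    have h2' : 1 / θ ^ 2 * E₀ = εs / (4 * Kc) := by rw [hE₀]; field_simp
    have h3' : (c : ℝ) * (εs / (4 * Kc)) ≤ Kc * (εs / (4 * Kc)) :=
      mul_le_mul_of_nonneg_right (by linarith) (by positivity)
    have h4' : Kc * (εs / (4 * Kc)) = εs / 4 := by field_simp
    calc (c : ℝ) * (1 / θ ^ 2 * E₀) = (c : ℝ) * (εs / (4 * Kc)) := by rw [h2']
      _ ≤ εs / 4 := by linarith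
  have hsmall : cknC (θ * ρ) z u + cknD (θ * ρ) z q < ENNReal.ofReal εs := by
    have hD' : cknD (θ * ρ) z q ≤ ENNReal.ofReal ((c : ℝ) * (θ * C₂ + 1 / θ ^ 2 * E₀)) := by
      refine hstep.trans ?_
      have e1 : ENNReal.ofReal θ * cknD ρ z q ≤ ENNReal.ofReal (θ * C₂) := by
        rw [ENNReal.ofReal_mul hθpos.le]
        gcongr
      have e2 : ENNReal.ofReal (1 / θ ^ 2) * cknC ρ z u ≤ ENNReal.ofReal (1 / θ ^ 2 * E₀) := by
        rw [ENNReal.ofReal_mul (by positivity)]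
        gcongr
      calc (c : ℝ≥0∞) * (ENNReal.ofReal θ * cknD ρ z q + ENNReal.ofReal (1 / θ ^ 2) * cknC ρ z u)
          ≤ (c : ℝ≥0∞) * (ENNReal.ofReal (θ * C₂) + ENNReal.ofReal (1 / θ ^ 2 * E₀)) := by
            gcongr (c : ℝ≥0∞) * ?_
            exact add_le_add e1 e2
        _ = ENNReal.ofReal ((c : ℝ) * (θ * C₂ + 1 / θ ^ 2 * E₀)) := by
            rw [← ENNReal.ofReal_add (by positivity) (by positivity), ← ENNReal.ofReal_coe_nnreal,
              ← ENNReal.ofReal_mul hc0]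
    calc cknC (θ * ρ) z u + cknD (θ * ρ) z q
        ≤ ENNReal.ofReal E₀ + ENNReal.ofReal ((c : ℝ) * (θ * C₂ + 1 / θ ^ 2 * E₀)) := add_le_add hC_small hD'
      _ = ENNReal.ofReal (E₀ + (c : ℝ) * (θ * C₂ + 1 / θ ^ 2 * E₀)) := by
          rw [← ENNReal.ofReal_add hE₀pos.le (by positivity)]
      _ < ENNReal.ofReal εs := by
          rw [ENNReal.ofReal_lt_ofReal_iff hεs]
          nlinarith [mul_add (c : ℝ) (θ * C₂) (1 / θ ^ 2 * E₀)]
  -- ε-regularity with all derivatives at scale `θρ`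
  exact H3 T u p q hframe z (θ * ρ) hθρ hθρz hzT hIn hsmall

end Summit.NavierStokesRegularity.NavierStokesRegularity.Cruxes.TypeIQuantSubcubicExp.FlatChain

end
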